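import Literature.Topology.FourManifolds.TwistedAxisSatellite
import Literature.Topology.FourManifolds.KirbyMovesMirrorProofs
import Literature.Topology.FourManifolds.KnotsMirrorProofs
import HarnessLib

/-!
# Twisted satellites along an axis: reversal and mirror image

Sibling proof file of `TwistedAxisSatellite.lean` (topic `Literature/Topology/FourManifolds`):
the first items of the API of `Knot.IsTwistedAxisSatellite K η J t K₁` ("`K₁` is the `t`-twisted
satellite with companion `J` and pattern `(K, η)`", splice form) and `Knot.IsAxisPattern K η`
asked for with the definition — the behaviour under the symmetries of `Knots.lean`, the
**reverse** `K.reverse = K ∘ reflectLast 1` and the **mirror image** `K.mirror = reflectLast 3 ∘ K`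
(Rolfsen, *Knots and Links* (1976), §3.C). Everything is PROVED; no definitions of notions, no
named facts (two auxiliary diffeomorphisms of knot complements are `def`s).

* `Knot.IsTwistedAxisSatellite.reverse_axis_companion` —
  `IsTwistedAxisSatellite K η J t K₁ → IsTwistedAxisSatellite K η.reverse J.reverse t K₁`:
  reversing the axis AND the companion presents the same satellite (the orientation of the
  companion only matters relative to the string orientation of the solid torus `S³ ∖ N̊(η)`,
  Lewark–Zibrowius (2024), Def. 2.7). Same gluing maps; the reversed tubular neighbourhoods
  `ν.reverseKnot (x, w) = ν (x̄, w̄)` of `KirbyMovesReverseProofs.lean` (same framing,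
  `HasFraming.reverseKnot`) relate the same ambient points (`spliceRel_reverseKnot_iff`).
* `Knot.IsTwistedAxisSatellite.mirror` —
  `IsTwistedAxisSatellite K η J t K₁ → IsTwistedAxisSatellite K.mirror η.mirror J.mirror.reverse (-t) K₁.mirror`:
  reflect all data by `R = reflectLast 3`. The mirrored tubular neighbourhoods
  `ν.mirrorKnot (x, w) = R (ν (x, w̄))` of `KirbyMovesMirrorProofs.lean` are again oriented
  (`det_pos`: ambient and fibre reflections cancel) with NEGATED framing (`HasFraming.mirrorKnot`),
  so `νη ↦ ν̄η` (framing `0`) and `νJ ↦ ν̄J.reverse` (framing `-t`; the extra reversal of the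
  companion tube puts the reflected relation back into the shape of `spliceRel`,
  `spliceRel_mirrorKnot_iff`); the gluing maps are conjugated by `R` (`R ∘ jA ∘ R`, `R ∘ jB ∘ R`
  on the reflected complements, `Knot.reflectComplDiffeo`), and `ν̄₁ = (R jA R) ∘ ν̄K`.
  `Knot.IsTwistedAxisSatellite.mirror_reverse_axis`: equivalently the AXIS may be reversed instead
  of the companion (`… K.mirror η.mirror.reverse J.mirror (-t) K₁.mirror`). For a pattern
  `P ⊂ S¹ × D²` this is the rule `mirror (P_t(J)) = P̄_{-t}(J̄)`, the mirrored pattern `P̄` keeping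
  its string orientation (whence the reversed axis), `J̄ = J.mirror`.
* `Knot.IsAxisPattern.mirror` — `IsAxisPattern K η → IsAxisPattern K.mirror η.mirror`: the
  reflected axis is unknotted (`Knot.mirror_unknot : unknot.mirror = unknot` on the nose,
  `Knot.IsUnknot.mirror`), `lk` becomes `-0 = 0` (`Knot.HasLinkingNumber.mirror'`,
  `KirbyMovesMirrorProofs.lean`; Rolfsen (1976), §5.D), and a spanning disc of `η` meeting `K`
  twice reflects, by the linear reflection `reflectLastCLM 3` of `ℝ⁴`, to one for the mirror
  images (`Knot.IsSpanningDiscMeetingTwice.mirror`).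

Not here: `IsAxisPattern K η → IsAxisPattern K η.reverse` (needs an ambient isotopy
`unknot.reverse ≅ unknot`, a rotation of `S³`, and `lk(η.reverse, K) = -lk(η, K)` via the symmetry
of the linking number); existence / uniqueness of the satellite; `P₀(U) ≅ K`.

## References

* L. Lewark, C. Zibrowius, *Rasmussen invariants of Whitehead doubles and other satellites*,
  J. reine angew. Math. 816 (2024), arXiv:2208.13612, Def. 2.7–2.8. [LewarkZibrowius2024]
* D. Rolfsen, *Knots and Links* (1976), §3.C (mirror image, reverse), §5.D (linking numbers
  change sign under reflection). [Rolfsen1976]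
-/

open scoped Manifold ContDiff
open Function Set

noncomputable section

namespace Literature.Topology.FourManifolds

/-- Local notation: `𝔼 n` is the model Euclidean space `EuclideanSpace ℝ (Fin n)`. -/
local notation "𝔼 " n:arg => EuclideanSpace ℝ (Fin n)

/-- Local notation: `𝕊 n` is the unit sphere in `EuclideanSpace ℝ (Fin (n + 1))`, the standard
`n`-sphere with its Mathlib manifold structure. -/
local notation "𝕊 " n:arg => (Metric.sphere (0 : EuclideanSpace ℝ (Fin (n + 1))) 1)

/-- Local notation: `𝔻²` is the closed unit disc in `ℝ²`. -/
local notation "𝔻²" => Metric.closedBall (0 : EuclideanSpace ℝ (Fin 2)) 1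

namespace Knot

/-! ### Identifications of knot complements -/

/-- The identity map between the complements of two knots with the same image, as a
diffeomorphism of open submanifolds of `𝕊 3` (e.g. `K` and its reverse `K.reverse`). [folklore] -/
def complementCastDiffeo (K K' : Knot) (h : range ⇑K = range ⇑K') :
    K.complement ≃ₘ⟮𝓡 3, 𝓡 3⟯ K'.complement where
  toFun a := ⟨a, by rw [SphereEmbedding.mem_complement_iff, ← h]; exact a.2⟩
  invFun a := ⟨a, by rw [SphereEmbedding.mem_complement_iff, h]; exact a.2⟩
  left_inv _ := rfl
  right_inv _ := rfl
  contMDiff_toFun := (ContMDiff.subtypeVal_comp_iff K'.complement _).1 contMDiff_subtype_val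
  contMDiff_invFun := (ContMDiff.subtypeVal_comp_iff K.complement _).1 contMDiff_subtype_val

/-- The identity diffeomorphism of complements, on points. [folklore] -/
@[simp] theorem coe_complementCastDiffeo_apply (K K' : Knot) (h : range ⇑K = range ⇑K')
    (a : K.complement) : (complementCastDiffeo K K' h a : 𝕊 3) = a := rfl

/-- The reflection `reflectLast 3` of `𝕊 3` restricts to a diffeomorphism from the complement of
a knot `K'` whose image is the reflected image of `K` (e.g. `K' = K.mirror`, or
`K' = K.mirror.reverse`) onto the complement of `K`. [folklore] -/
def reflectComplDiffeo (K K' : Knot) (h : range ⇑K' = reflectLast 3 '' range ⇑K) :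
    K'.complement ≃ₘ⟮𝓡 3, 𝓡 3⟯ K.complement where
  toFun a := ⟨reflectLast 3 a, by
    rw [SphereEmbedding.mem_complement_iff]
    intro hx
    apply (SphereEmbedding.mem_complement_iff K' a).1 a.2
    rw [h]
    exact ⟨reflectLast 3 a, hx, reflectLast_reflectLast 3 _⟩⟩
  invFun a := ⟨reflectLast 3 a, by
    rw [SphereEmbedding.mem_complement_iff, h, (involutive_reflectLast 3).injective.mem_set_image]
    exact a.2⟩
  left_inv a := Subtype.ext (reflectLast_reflectLast 3 _)
  right_inv a := Subtype.ext (reflectLast_reflectLast 3 _)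
  contMDiff_toFun := (ContMDiff.subtypeVal_comp_iff K.complement _).1
    ((contMDiff_reflectLast 3).comp contMDiff_subtype_val)
  contMDiff_invFun := (ContMDiff.subtypeVal_comp_iff K'.complement _).1
    ((contMDiff_reflectLast 3).comp contMDiff_subtype_val)

/-- The reflection diffeomorphism of complements, on points. [folklore] -/
@[simp] theorem coe_reflectComplDiffeo_apply (K K' : Knot)
    (h : range ⇑K' = reflectLast 3 '' range ⇑K) (a : K'.complement) :
    (reflectComplDiffeo K K' h a : 𝕊 3) = reflectLast 3 a := rfl

/-- The image of the reversed mirror image `-K̄ = K.mirror.reverse` is the reflected image of `K`.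
[folklore] -/
theorem range_mirror_reverse (K : Knot) : range ⇑K.mirror.reverse = reflectLast 3 '' range ⇑K := by
  rw [range_reverse, range_mirror]

namespace TubularNbhd

variable {K : Knot} (ν : Knot.TubularNbhd K)

/-- The reversed tubular neighbourhood `ν.reverseKnot` of `K.reverse` on points (`reverse_apply`
at the type of `K.reverse`). [folklore] -/
@[simp] theorem reverseKnot_apply (p : (𝕊 1) × (𝔼 2)) :
    ν.reverseKnot p = ν (reflectLast 1 p.1, planeFlip p.2) := rfl

/-- The mirrored tubular neighbourhood `ν.mirrorKnot` of `K.mirror` on points (`mirror_apply` at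
the type of `K.mirror`). [folklore] -/
@[simp] theorem mirrorKnot_apply (p : (𝕊 1) × (𝔼 2)) :
    ν.mirrorKnot p = reflectLast 3 (ν (p.1, planeFlip p.2)) := rfl

end TubularNbhd

end Knot

/-! ### The splice relation under reversal and reflection -/

/-- **Reversing both the axis and the companion does not change the splice relation**: the
reversed tubular neighbourhoods (`Knot.TubularNbhd.reverseKnot`: `(x, w) ↦ ν (x̄, w̄)`) relate the
same pairs of ambient points, `νη (ū, s • v̄) ∼ νJ (v̄, (1 - s) • ū)` being the relation of `νη`,
`νJ` at the reflected parameters. [folklore] -/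
theorem spliceRel_reverseKnot_iff {η J : Knot} (νη : Knot.TubularNbhd η) (νJ : Knot.TubularNbhd J)
    (a : (η.reverse : Knot).complement) (b : (J.reverse : Knot).complement)
    (a₀ : η.complement) (b₀ : J.complement) (ha : (a₀ : 𝕊 3) = a) (hb : (b₀ : 𝕊 3) = b) :
    spliceRel νη.reverseKnot νJ.reverseKnot a b ↔ spliceRel νη νJ a₀ b₀ := by
  simp only [spliceRel_iff, Knot.TubularNbhd.reverseKnot_apply, map_smul, planeFlip_coe_sphere, ha,
    hb]
  constructor
  · rintro ⟨u, v, s, hs, hau, hbv⟩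
    exact ⟨reflectLast 1 u, reflectLast 1 v, s, hs, hau, hbv⟩
  · rintro ⟨u, v, s, hs, hau, hbv⟩
    refine ⟨reflectLast 1 u, reflectLast 1 v, s, hs, ?_, ?_⟩
    · simpa only [reflectLast_reflectLast] using hau
    · simpa only [reflectLast_reflectLast] using hbv

/-- **The splice relation of the mirrored axis tube and the mirrored, reversed companion tube** is
the splice relation of `νη`, `νJ` at the reflected points: with `ν̄ (x, w) = R (ν (x, w̄))`
(`Knot.TubularNbhd.mirrorKnot`, `R = reflectLast 3`) one has `ν̄η (u, s • v) = R (νη (u, s • v̄))`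
and `ν̄J.reverse (v, (1 - s) • u) = R (νJ (v̄, (1 - s) • u))`, so substituting `v̄` for `v`
gives the relation of `νη`, `νJ` between `R a` and `R b`. [folklore] -/
theorem spliceRel_mirrorKnot_iff {η J : Knot} (νη : Knot.TubularNbhd η) (νJ : Knot.TubularNbhd J)
    (a : (η.mirror : Knot).complement) (b : (J.mirror.reverse : Knot).complement)
    (a₀ : η.complement) (b₀ : J.complement) (ha : (a₀ : 𝕊 3) = reflectLast 3 a)
    (hb : (b₀ : 𝕊 3) = reflectLast 3 b) :
    spliceRel νη.mirrorKnot νJ.mirrorKnot.reverseKnot a b ↔ spliceRel νη νJ a₀ b₀ := by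
  simp only [spliceRel_iff, Knot.TubularNbhd.reverseKnot_apply, Knot.TubularNbhd.mirrorKnot_apply,
    map_smul, planeFlip_coe_sphere, reflectLast_reflectLast, ha, hb]
  constructor
  · rintro ⟨u, v, s, hs, hau, hbv⟩
    refine ⟨u, reflectLast 1 v, s, hs, ?_, ?_⟩
    · rw [hau, reflectLast_reflectLast]
    · rw [hbv, reflectLast_reflectLast]
  · rintro ⟨u, v, s, hs, hau, hbv⟩
    refine ⟨u, reflectLast 1 v, s, hs, ?_, ?_⟩
    · rw [reflectLast_reflectLast 1 v, ← hau, reflectLast_reflectLast]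
    · rw [reflectLast_reflectLast 1 v, ← hbv, reflectLast_reflectLast]

namespace Knot

namespace IsTwistedAxisSatellite

variable {K η J K₁ : Knot} {t : ℤ}

/-- **Reversing the axis and the companion simultaneously gives the same satellite**: the
satellite construction sees the orientation of the companion `J` only through its matching with
the orientation of the axis `η` (the string orientation of the solid torus `S³ ∖ N̊(η)`), so
`P_t` with axis `η.reverse` and companion `J.reverse` is again `K₁` — same gluing maps, reversed
tubular neighbourhoods (`spliceRel_reverseKnot_iff`; framings are unchanged under reversal,
`Knot.TubularNbhd.HasFraming.reverseKnot`). Lewark–Zibrowius (2024), Def. 2.7 (orientation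
conventions of `ι_K`). [folklore] -/
theorem reverse_axis_companion (h : IsTwistedAxisSatellite K η J t K₁) :
    IsTwistedAxisSatellite K η.reverse J.reverse t K₁ := by
  obtain ⟨νη, νJ, jA, jB, h0, ht, hKν, ⟨hA, hAo, hB, hBo, hcov, hrel⟩, νK, hνK, ν₁, hν⟩ := h
  set eη := complementCastDiffeo (η.reverse : Knot) η (range_reverse η) with heη
  set eJ := complementCastDiffeo (J.reverse : Knot) J (range_reverse J) with heJ
  refine ⟨νη.reverseKnot, νJ.reverseKnot, jA ∘ eη, jB ∘ eJ,
    Knot.TubularNbhd.HasFraming.reverseKnot νη h0, Knot.TubularNbhd.HasFraming.reverseKnot νJ ht, ?_,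
    ⟨hA.comp_diffeomorph eη, ?_, hB.comp_diffeomorph eJ, ?_, ?_, fun a b ↦ ?_⟩, νK, ?_, ν₁, fun p ↦ ?_⟩
  · change Disjoint (range ⇑K) (range ⇑νη.reverse)
    rwa [Knot.TubularNbhd.range_reverse]
  · rwa [(EquivLike.surjective eη).range_comp]
  · rwa [(EquivLike.surjective eJ).range_comp]
  · rwa [(EquivLike.surjective eη).range_comp, (EquivLike.surjective eJ).range_comp]
  · exact (hrel (eη a) (eJ b)).trans (spliceRel_reverseKnot_iff νη νJ a b (eη a) (eJ b) rfl rfl).symm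
  · rwa [range_reverse]
  · exact hν p

/-- **The mirror image of a twisted satellite**: reflecting everything by `R = reflectLast 3`,
the mirror image `K₁.mirror` of the `t`-twisted satellite with pattern `(K, η)` and companion `J`
is the `(-t)`-twisted satellite with pattern `(K.mirror, η.mirror)` and companion the reversed
mirror image `J.mirror.reverse`. The new presentation: the mirrored tubular neighbourhoods
`ν̄ (x, w) = R (ν (x, w̄))` (`Knot.TubularNbhd.mirrorKnot`, oriented since the ambient and the
fibre reflections cancel in `det_pos`; framings negated, `HasFraming.mirrorKnot`, so `0 ↦ 0`,
`t ↦ -t`), the companion tube moreover reversed (`reverseKnot`, framing kept) so that the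
reflected relation is again of the shape `spliceRel` (`spliceRel_mirrorKnot_iff`), and the
gluing maps conjugated by `R` (`R ∘ jA ∘ R`, `R ∘ jB ∘ R` on the reflected complements,
`Knot.reflectComplDiffeo`); the tubes of `K` and `K₁` are mirrored too, `ν̄₁ = (R jA R) ∘ ν̄K`.
Equivalently (`mirror_reverse_axis`) the axis may be reversed instead of the companion. For the
satellite of a pattern `P ⊂ S¹ × D²` this is the rule `\overline{P_t(J)} = \overline{P}_{-t}(J̄)`
with the mirrored pattern keeping its string orientation. Lewark–Zibrowius (2024), Def. 2.7–2.8;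
Rolfsen (1976), §3.C. [folklore] -/
theorem mirror (h : IsTwistedAxisSatellite K η J t K₁) :
    IsTwistedAxisSatellite K.mirror η.mirror J.mirror.reverse (-t) K₁.mirror := by
  obtain ⟨νη, νJ, jA, jB, h0, ht, hKν, ⟨hA, hAo, hB, hBo, hcov, hrel⟩, νK, hνK, ν₁, hν⟩ := h
  set eη := reflectComplDiffeo η η.mirror (range_mirror η) with heη
  set eJ := reflectComplDiffeo J J.mirror.reverse (range_mirror_reverse J) with heJ
  refine ⟨νη.mirrorKnot, νJ.mirrorKnot.reverseKnot, ⇑(reflectLastDiffeo 3) ∘ (jA ∘ eη),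
    ⇑(reflectLastDiffeo 3) ∘ (jB ∘ eJ), ?_, ?_, ?_,
    ⟨(hA.comp_diffeomorph eη).diffeomorph_comp _, ?_, (hB.comp_diffeomorph eJ).diffeomorph_comp _,
      ?_, ?_, fun a b ↦ ?_⟩, νK.mirrorKnot, ?_, ν₁.mirrorKnot, fun p ↦ ?_⟩
  · simpa using Knot.TubularNbhd.HasFraming.mirrorKnot νη h0
  · exact Knot.TubularNbhd.HasFraming.reverseKnot _ (Knot.TubularNbhd.HasFraming.mirrorKnot νJ ht)
  · change Disjoint (range ⇑K.mirror) (range ⇑νη.mirror)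
    rw [range_mirror, Knot.TubularNbhd.range_mirror]
    exact (Set.disjoint_image_iff (involutive_reflectLast 3).injective).2 hKν
  · rw [range_comp, (EquivLike.surjective eη).range_comp]
    exact (reflectLastDiffeo 3).toHomeomorph.isOpenMap _ hAo
  · rw [range_comp, (EquivLike.surjective eJ).range_comp]
    exact (reflectLastDiffeo 3).toHomeomorph.isOpenMap _ hBo
  · rw [range_comp, (EquivLike.surjective eη).range_comp, range_comp,
      (EquivLike.surjective eJ).range_comp, ← image_union, hcov, image_univ]
    exact (reflectLastDiffeo 3).surjective.range_eq
  · change reflectLast 3 (jA (eη a)) = reflectLast 3 (jB (eJ b)) ↔ _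
    rw [(involutive_reflectLast 3).injective.eq_iff, hrel (eη a) (eJ b)]
    exact (spliceRel_mirrorKnot_iff νη νJ a b (eη a) (eJ b) rfl rfl).symm
  · change Disjoint (range ⇑νK.mirror) (range ⇑η.mirror)
    rw [range_mirror, Knot.TubularNbhd.range_mirror]
    exact (Set.disjoint_image_iff (involutive_reflectLast 3).injective).2 hνK
  · change reflectLast 3 (ν₁ (p.1, planeFlip p.2)) = reflectLast 3 (jA (eη ⟨νK.mirror p, _⟩))
    rw [hν (p.1, planeFlip p.2)]
    congr 2
    apply Subtype.ext
    change (νK (p.1, planeFlip p.2) : 𝕊 3) = reflectLast 3 (reflectLast 3 (νK (p.1, planeFlip p.2)))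
    rw [reflectLast_reflectLast]

/-- **The mirror image of a twisted satellite, axis reversed**: equivalently to `mirror`, the
mirror image `K₁.mirror` is the `(-t)`-twisted satellite with pattern `(K.mirror, η.mirror.reverse)`
(reflected axis with reversed orientation) and companion the mirror image `J.mirror`
(`mirror` followed by `reverse_axis_companion`). [folklore] -/
theorem mirror_reverse_axis (h : IsTwistedAxisSatellite K η J t K₁) :
    IsTwistedAxisSatellite K.mirror η.mirror.reverse J.mirror (-t) K₁.mirror := by
  simpa only [SphereEmbedding.reverse_reverse] using h.mirror.reverse_axis_companion

end IsTwistedAxisSatellite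

/-! ### Axis patterns under reflection -/

/-- The unknot is its own mirror image on the nose: the reflection `reflectLast 3` negates the
last coordinate, which vanishes on the standard great circle `(x₀, x₁, 0, 0)`. [folklore] -/
theorem mirror_unknot : (unknot : Knot).mirror = unknot := by
  apply SphereEmbedding.ext
  funext x
  change reflectLast 3 (unknot x) = unknot x
  apply Subtype.ext
  ext i
  by_cases hi : i = Fin.last 3
  · subst hi
    have h0 : ((unknot x : 𝕊 3) : 𝔼 4) (Fin.last 3) = 0 := by
      simp [unknot, euclideanInclusion_apply]
    rw [reflectLast_apply_last, h0, neg_zero]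
  · rw [reflectLast_apply_of_ne_last 3 _ hi]

/-- The mirror image of an unknotted knot is unknotted. Rolfsen (1976), §3.C. [folklore] -/
theorem IsUnknot.mirror {K : Knot} (h : K.IsUnknot) : K.mirror.IsUnknot := by
  have e : SphereEmbedding.mirror unknot = unknot := mirror_unknot
  have := SphereEmbedding.IsIsotopic.mirror h
  rw [e] at this
  exact this

/-- **A reflected spanning disc**: if `f` is a smoothly embedded spanning disc of `η` in `S³`
meeting `K` in exactly two points, then `R ∘ f` (`R = reflectLastCLM 3`, the linear reflection of
`ℝ⁴` restricting to `reflectLast 3` on `𝕊 3`) is one for the mirror images `η.mirror`, `K.mirror`.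
[folklore] -/
theorem IsSpanningDiscMeetingTwice.mirror {η K : Knot} {f : 𝔼 2 → 𝔼 4}
    (h : IsSpanningDiscMeetingTwice η K f) :
    IsSpanningDiscMeetingTwice η.mirror K.mirror (reflectLastCLM 3 ∘ f) := by
  obtain ⟨hf, hinj, himm, hsph, hbd, hcard⟩ := h
  have h1 : ∀ v : 𝔼 4, reflectLastCLM 3 (reflectLastCLM 3 v) = v := fun v ↦ by
    ext j
    simp only [reflectLastCLM_three_apply]
    split_ifs <;> simp
  have hRinj : Injective (reflectLastCLM 3) := Function.LeftInverse.injective h1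
  refine ⟨(reflectLastCLM 3).contDiff.comp hf, hRinj.comp_injOn hinj, fun x hx ↦ ?_, fun x hx ↦ ?_,
    fun x ↦ ?_, ?_⟩
  · have hdf : DifferentiableAt ℝ f x := hf.differentiable (by simp) x
    rw [((reflectLastCLM 3).hasFDerivAt.comp x hdf.hasFDerivAt).fderiv]
    exact hRinj.comp (himm x hx)
  · have : reflectLastCLM 3 (f x) = ((reflectLast 3 ⟨f x, hsph x hx⟩ : 𝕊 3) : 𝔼 4) := rfl
    rw [comp_apply, this]
    exact (reflectLast 3 _).2
  · rw [comp_apply, hbd x]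
    rfl
  · have hset : {x : 𝔼 2 | x ∈ 𝔻² ∧ (reflectLastCLM 3 ∘ f) x ∈
        (Subtype.val '' range ⇑K.mirror : Set (𝔼 4))} =
        {x : 𝔼 2 | x ∈ 𝔻² ∧ f x ∈ (Subtype.val '' range ⇑K : Set (𝔼 4))} := by
      ext x
      simp only [mem_setOf_eq, comp_apply, and_congr_right_iff]
      intro _
      rw [range_mirror, image_image]
      have : (fun y : 𝕊 3 ↦ ((reflectLast 3 y : 𝕊 3) : 𝔼 4)) = reflectLastCLM 3 ∘ Subtype.val := rfl
      rw [this, image_comp, hRinj.mem_set_image]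
    rw [hset, hcard]

/-- **The mirror image of an axis pattern is an axis pattern** (for the mirrored axis): the
mirrored axis is unknotted (`IsUnknot.mirror`), still disjoint from the mirrored knot, the
linking number becomes `-0 = 0` (`Knot.HasLinkingNumber.mirror'`, Rolfsen (1976), §5.D), and a
spanning disc meeting `K` twice reflects to one for the mirror images
(`IsSpanningDiscMeetingTwice.mirror`). [folklore] -/
theorem IsAxisPattern.mirror {K η : Knot} (h : IsAxisPattern K η) : IsAxisPattern K.mirror η.mirror := by
  obtain ⟨hU, hd, hlk, f, hf⟩ := h
  refine ⟨hU.mirror, disjoint_range_mirror hd, ?_, reflectLastCLM 3 ∘ f, hf.mirror⟩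
  simpa using hlk.mirror'

end Knot

end Literature.Topology.FourManifolds
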